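import Literature.AlgebraicGeometry.ModuliOfAbelianVarieties.SiegelShimuraSet
import HarnessLib

/-!
# The half-swap `γ₀ = diag(1_g, -1_g) ∈ GSp_δ` (multiplier `-1`): `X⁻ → X⁺`

[cite: Milne2005ShimuraVarieties, §6 p. 68 («X = X⁺ ⊔ X⁻ … GSp(ℝ) acts transitively; elements of negative multiplier
interchange X⁺ and X⁻»)] [cite: Lange2023AbelianVarietiesComplex, §7.1.2 Prop. 7.1.9 (p0328)]

Over any commutative ring `R`, `halfSwap R g := diag(1_g, -1_g) ∈ GL_{g⊕g}(R)` satisfies `ᵗγ₀ E_δ γ₀ = -E_δ`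
(`isMultiplier_halfSwap`), so `γ₀ ∈ GSp_δ(ℚ)` / `GSp_δ(ℝ)` with multiplier `-1`, `gspRationalToReal` carries the rational
one to the real one, and conjugation by `γ₀` moves Lange's `X⁻ = -C0 δ` onto `X⁺ = C0 δ` (`conjJ_halfSwap_mem_C0`, from ★
`neg_conjJ_mem_C0_of_neg`).  Use: the holomorphic identification of the `X⁻` half with `𝔥_g` (period maps of complex
structures landing in `X⁻`, e.g. ★ `UnitaryAuxiliaryComplexStructure.neg_auxComplexStructure_mem_C0`).
-/

set_option autoImplicit false

namespace Literature.AlgebraicGeometry.ModuliOfAbelianVarieties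

open Matrix SiegelModuli

variable {g : ℕ}

/-- **`γ₀ = diag(1_g, -1_g) ∈ GL_{g⊕g}(R)`** (an involution). [cite: Milne2005ShimuraVarieties, §6 p. 68] -/
def halfSwap (R : Type*) [CommRing R] (g : ℕ) : GL (Fin g ⊕ Fin g) R where
  val := Matrix.fromBlocks 1 0 0 (-1)
  inv := Matrix.fromBlocks 1 0 0 (-1)
  val_inv := by rw [Matrix.fromBlocks_multiply]; simp
  inv_val := by rw [Matrix.fromBlocks_multiply]; simp

variable (R : Type*) [CommRing R]

/-- Underlying matrix of `γ₀`. [cite: Milne2005ShimuraVarieties, §6 p. 68] -/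
@[simp] theorem coe_halfSwap : ((halfSwap R g : GL (Fin g ⊕ Fin g) R) : Matrix (Fin g ⊕ Fin g) (Fin g ⊕ Fin g) R) =
    Matrix.fromBlocks 1 0 0 (-1) := rfl

/-- `γ₀⁻¹ = γ₀`. [cite: Milne2005ShimuraVarieties, §6 p. 68] -/
@[simp] theorem halfSwap_inv : (halfSwap R g)⁻¹ = halfSwap R g := rfl

/-- **`ᵗγ₀ E_δ γ₀ = -E_δ`**: `γ₀` is a symplectic similitude of multiplier `-1`. [cite: Milne2005ShimuraVarieties, §6 pp. 67–68] -/
theorem isMultiplier_halfSwap (δ : Fin g → ℕ) : IsMultiplier (typeFormOver δ R) (halfSwap R g) (-1) := by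
  rw [isMultiplier_iff, coe_halfSwap, typeFormOver, typeForm, Matrix.fromBlocks_map, Matrix.fromBlocks_transpose,
    Matrix.fromBlocks_multiply, Matrix.fromBlocks_multiply, Units.val_neg, Units.val_one, neg_one_smul,
    Matrix.fromBlocks_neg]
  simp

/-- `γ₀ ∈ GSp(E_δ)(R)`. [cite: Milne2005ShimuraVarieties, §6 p. 67] -/
theorem halfSwap_mem_similitudeGroupOfForm (δ : Fin g → ℕ) : halfSwap R g ∈ similitudeGroupOfForm (typeFormOver δ R) :=
  ⟨-1, isMultiplier_halfSwap R δ⟩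

/-- `γ₀ ∈ GSp_δ(ℚ)`. [cite: Milne2005ShimuraVarieties, §6 p. 70] -/
theorem halfSwap_mem_gspRational (δ : Fin g → ℕ) : halfSwap ℚ g ∈ gspRational δ :=
  halfSwap_mem_similitudeGroupOfForm ℚ δ

/-- `γ₀ ∈ GSp_δ(ℝ)`. [cite: Milne2005ShimuraVarieties, §6 p. 68] -/
theorem halfSwap_mem_gspReal (δ : Fin g → ℕ) : halfSwap ℝ g ∈ gspReal δ :=
  halfSwap_mem_similitudeGroupOfForm ℝ δ

/-- `γ₀` is defined over `ℤ`: every ring map carries it to itself. [cite: Milne2005ShimuraVarieties, §6 p. 68] -/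
theorem map_halfSwap {S : Type*} [CommRing S] (f : R →+* S) :
    Matrix.GeneralLinearGroup.map f (halfSwap R g) = halfSwap S g := by
  apply Units.ext
  change ((halfSwap R g : GL (Fin g ⊕ Fin g) R) : Matrix (Fin g ⊕ Fin g) (Fin g ⊕ Fin g) R).map f = _
  rw [coe_halfSwap, coe_halfSwap, Matrix.fromBlocks_map]
  refine Matrix.fromBlocks_inj.2 ⟨Matrix.map_one f (map_zero f) (map_one f), Matrix.map_zero f (map_zero f),
    Matrix.map_zero f (map_zero f), ?_⟩
  ext i j
  simp [Matrix.one_apply, apply_ite f]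

/-- The rational `γ₀` maps to the real `γ₀` under ★ `gspRationalToReal`. [cite: Milne2005ShimuraVarieties, §6 p. 70] -/
theorem gspRationalToReal_halfSwap (δ : Fin g → ℕ) :
    (gspRationalToReal δ ⟨halfSwap ℚ g, halfSwap_mem_gspRational δ⟩ : GL (Fin g ⊕ Fin g) ℝ) = halfSwap ℝ g := by
  rw [coe_gspRationalToReal]
  exact map_halfSwap ℚ (algebraMap ℚ ℝ)

/-- `γ₀ J γ₀⁻¹ = γ₀ J γ₀`. [cite: Milne2005ShimuraVarieties, §6 p. 68] -/
theorem conjJ_halfSwap (J : Matrix (Fin g ⊕ Fin g) (Fin g ⊕ Fin g) ℝ) :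
    conjJ (halfSwap ℝ g) J = Matrix.fromBlocks 1 0 0 (-1) * J * Matrix.fromBlocks 1 0 0 (-1) := by
  rw [conjJ_def, halfSwap_inv, coe_halfSwap]

/-- **`γ₀` moves `X⁻` onto `X⁺`**: if `-J ∈ C0 δ` then `γ₀ J γ₀⁻¹ ∈ C0 δ` (negative multiplier swaps the halves,
★ `neg_conjJ_mem_C0_of_neg`). [cite: Milne2005ShimuraVarieties, §6 p. 68] [cite: Lange2023AbelianVarietiesComplex, §7.1.2 Prop. 7.1.9 (p0328)] -/
theorem conjJ_halfSwap_mem_C0 {δ : Fin g → ℕ} {J : Matrix (Fin g ⊕ Fin g) (Fin g ⊕ Fin g) ℝ} (hJ : -J ∈ C0 δ) :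
    conjJ (halfSwap ℝ g) J ∈ C0 δ := by
  have hM : IsMultiplier (realTypeForm δ) (halfSwap ℝ g) (-1) := by
    rw [← typeFormOver_real_eq_realTypeForm]; exact isMultiplier_halfSwap ℝ δ
  have h := neg_conjJ_mem_C0_of_neg hM (by rw [Units.val_neg, Units.val_one]; norm_num) hJ
  rwa [conjJ_neg, neg_neg] at h

/-- Conversely `γ₀` moves `X⁺` onto `X⁻`. [cite: Milne2005ShimuraVarieties, §6 p. 68] -/
theorem neg_conjJ_halfSwap_mem_C0 {δ : Fin g → ℕ} {J : Matrix (Fin g ⊕ Fin g) (Fin g ⊕ Fin g) ℝ} (hJ : J ∈ C0 δ) :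
    -conjJ (halfSwap ℝ g) J ∈ C0 δ := by
  have hM : IsMultiplier (realTypeForm δ) (halfSwap ℝ g) (-1) := by
    rw [← typeFormOver_real_eq_realTypeForm]; exact isMultiplier_halfSwap ℝ δ
  exact neg_conjJ_mem_C0_of_neg hM (by rw [Units.val_neg, Units.val_one]; norm_num) hJ

end Literature.AlgebraicGeometry.ModuliOfAbelianVarieties
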